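import Mathlib.Algebra.BigOperators.Group.Finset.Basic
import Mathlib.Algebra.BigOperators.Pi
import Mathlib.Algebra.Module.Pi
import Mathlib.Algebra.Field.Basic
import Mathlib.Tactic
import HarnessLib

/-!
# Reduced-echelon bases of stable subspaces are eigenbases

Kernel leaf for the W1 engine week (cell `pub-hsemireg`, seat w1-tw-2 gen 11): the statement behind
«a coordinate-projection SDR built by reduced row echelon in a monomial (character-eigen) coordinate
system is automatically `ζ`-equivariant» (surface kernels of w1-tw-2 `surface_x2` and w1-cx-2 `cechS_codeB`;
M3CHAR-w1aut1 §6 (b)).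

Setting: coordinates `ι → K` on which an operator acts DIAGONALLY, `x ↦ (k ↦ χ k * x k)`.  A family
`v : Fin m → (ι → K)` is in REDUCED ECHELON FORM with pivots `piv : Fin m → ι` if `v j (piv i) = δ_{ij}`.
If the span of the family is stable under the diagonal operator — here in the concrete form «`χ • v j`
(pointwise) is a linear combination of the `v i`» — then every `v j` is an EIGENVECTOR with eigenvalue
`χ (piv j)`: reading the combination at the pivot coordinates forces all coefficients but the `j`-th to
vanish.  Consequently `v j` is supported on the coordinates of character `χ (piv j)`.

Honest framing: elementary linear algebra (theorems only); nothing here bears on HC / HC_CM / HC_AV.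
-/

namespace Summit.Ventures.HSemireg.EchelonEigenbasis

open Finset

variable {K : Type*} [Field K] {ι : Type*} {m : ℕ}

/-- Reading a linear combination of a reduced-echelon family (the `j`-th vector has coordinate `1` at its
own pivot `piv j` and `0` at every other pivot) at the `i`-th pivot returns the `i`-th coefficient. -/
theorem combination_at_pivot {v : Fin m → ι → K} {piv : Fin m → ι}
    (hv : ∀ i j : Fin m, v j (piv i) = if i = j then 1 else 0) (c : Fin m → K) (i : Fin m) :
    (∑ l : Fin m, c l • v l) (piv i) = c i := by
  classical
  rw [Finset.sum_apply]
  simp only [Pi.smul_apply, smul_eq_mul]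
  have key : ∀ l : Fin m, c l * v l (piv i) = if i = l then c i else 0 := by
    intro l
    rw [hv i l]
    by_cases h : i = l
    · subst h; simp
    · simp [h]
  rw [Finset.sum_congr rfl (fun l _ => key l)]
  simp

/-- **Echelon eigenbasis lemma.** If the diagonal operator with character vector `χ` maps each vector of a
reduced-echelon family into the span of the family (stability, given as an explicit combination), then
each vector of the family is an eigenvector, with eigenvalue the character of its pivot coordinate. -/
theorem eigenvector_of_stable {v : Fin m → ι → K} {piv : Fin m → ι} (χ : ι → K)
    (hv : ∀ i j : Fin m, v j (piv i) = if i = j then 1 else 0)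
    (hstab : ∀ j : Fin m, ∃ c : Fin m → K, (fun k => χ k * v j k) = ∑ l : Fin m, c l • v l)
    (j : Fin m) :
    (fun k => χ k * v j k) = χ (piv j) • v j := by
  classical
  obtain ⟨c, hc⟩ := hstab j
  -- the coefficients are forced: c i = χ (piv i) * δ_{ij}
  have hcoef : ∀ i : Fin m, c i = if i = j then χ (piv j) else 0 := by
    intro i
    have h1 : (fun k => χ k * v j k) (piv i) = c i := by
      rw [hc]; exact combination_at_pivot hv c i
    have h2 : (fun k => χ k * v j k) (piv i) = χ (piv i) * v j (piv i) := rfl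
    rw [h2, hv i j] at h1
    by_cases h : i = j
    · subst h; simpa using h1.symm
    · simp [h] at h1; simp [h, h1]
  rw [hc]
  have : ∀ l : Fin m, c l • v l = if l = j then χ (piv j) • v j else 0 := by
    intro l; rw [hcoef l]; by_cases h : l = j
    · subst h; simp
    · simp [h]
  rw [Finset.sum_congr rfl (fun l _ => this l)]
  simp

/-- Coordinate form: a vector of a stable reduced-echelon family is supported on the coordinates whose
character equals the character of its pivot. -/
theorem coordinate_character {v : Fin m → ι → K} {piv : Fin m → ι} (χ : ι → K)
    (hv : ∀ i j : Fin m, v j (piv i) = if i = j then 1 else 0)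
    (hstab : ∀ j : Fin m, ∃ c : Fin m → K, (fun k => χ k * v j k) = ∑ l : Fin m, c l • v l)
    (j : Fin m) (k : ι) (hk : v j k ≠ 0) : χ k = χ (piv j) := by
  have h := congrArg (fun x => x k) (eigenvector_of_stable χ hv hstab j)
  simp only [Pi.smul_apply, smul_eq_mul] at h
  exact mul_right_cancel₀ hk h

/-- The converse direction used by the engines: a vector supported on the coordinates of ONE character is
an eigenvector of the diagonal operator for that character. -/
theorem eigenvector_of_support {x : ι → K} (χ : ι → K) (a : K)
    (hsupp : ∀ k : ι, x k ≠ 0 → χ k = a) :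
    (fun k => χ k * x k) = a • x := by
  funext k
  simp only [Pi.smul_apply, smul_eq_mul]
  by_cases hk : x k = 0
  · simp [hk]
  · rw [hsupp k hk]

end Summit.Ventures.HSemireg.EchelonEigenbasis
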